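import Summits.BirchSwinnertonDyer.BirchSwinnertonDyer.Theorems.UniversalToricDescentThinCombNodeSeries
import HarnessLib

/-!
# WILD RIGIDITY OF ♯♯-FRAMES: the grading ratio of a non-zero ♯♯-frame is a `ℤ₃`-POWER — `λ₀^{−m} = (1 + (u − 1))^z`, `z ∈ ℤ₃`, for the
# one-unit `u = χ(γ₁)` and the exponent `m` of a grid supply (one `(m, u)` for ALL frames)
# (helper on the rational wall `RationalSplitIMCInclusionAtThree`, stmt-BirchSwinnertonDyer-24207, line `ratwall_thin_comb` v10;
# cell `pub/bsd-wall`, LEAD `cruxlead-24207` g37; `--supports stmt-BirchSwinnertonDyer-24207`; nothing is closed; BSD is not proved)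

WHY THIS FILE. With `λ₀ = X·κ̂/Y` the grading ratio of a ♯♯-frame `L₂` (`IsToricTwoVarLFunctionUpTo₂ C X Y …`) and `G = φ_{A_τ}L₂` its reflection,
the grid supply (`…GridSupply`: types `(m(i+1), −m(j+1))`, points `P_{ij} = (v₁^{j+1}u^{i+1} − 1, v₂^{j+1} − 1)`) gives
`G(P_{ij})·μ^{i+1} = μ^{j+1}·L₂(P_{ij})`, `μ = λ₀^m`. SIZE rigidity (`…SizeRigidity`): `‖μ‖ = 1`; TAME rigidity (`…TameRigidity`): `μ` is a
one-unit. This file proves the WILD statement: **`μ⁻¹ = B_z(u − 1)` for some `z ∈ ℤ₃`**, where `B_z = (1+X)^z ∈ ℂ₃⟦X⟧` is THE binomial series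
(the solution of `(1 + X)·B′ = z·B` with `B(0) = 1`; integral). In words: `λ₀^{−m} = u^z` — the grading ratio is, up to the torsion index `m`,
a `ℤ₃`-power of the one-unit `u = χ(γ₁)` (the value at `γ₁` of the vertical character of the frame).

PROOF. On a fibre `j₀` carrying a non-zero value (one exists, else `L₂ = 0` by the fibred identity principle) the lines `T₂ = y_{j₀}` of `L₂`
and `G` are integral series `F, F′ ∈ ℂ₃⟦X⟧` (`…NodeSeries.exists_fibreSeries`); `F` has finitely many zeros on the closed disc `‖x‖ ≤ ‖3‖`, so
its node values are non-zero from an index `i₁` on (`exists_forall_le_ne_zero`); re-centring at the node `i₁` (`exists_recenter_rescale`, offset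
`a = v₁^{j₀+1}u^{i₁+1}`) produces integral `H, H′` with `H(uᵗ − 1) = L₂(P_{i₁+t, j₀})`, `H′(uᵗ − 1) = G(P_{i₁+t, j₀}) = c₀·(μ⁻¹)ᵗ·H(uᵗ − 1)`;
the tree's `ℂ_p` NODE THEOREM (`Literature…LocalFields.PadicComplex.exists_padicInt_binomial_twist_of_node_values`: Robert V.2.4 strict
differentiability + Strassman + Gouvêa §5.9 integrality of the exponent, WITHOUT unit content) gives `H′ = Q·H`, `(1+X)Q′ = zQ`, `z ∈ ℤ₃`;
evaluating at the nodes `t = 0, 1` (where `H ≠ 0`; evaluation is multiplicative on restricted series, `tsum_coeff_mul`) gives `Q(0) = c₀`,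
`Q(u − 1) = c₀·μ⁻¹`, and `B_z = Q/Q(0)`.

* **`exists_forall_binomialPower_eq_of_isToricTwoVarLFunctionUpTo₂`** (`p = 3`; Jacquet's cone fact BY NAME): there are `m > 0` and a one-unit `u`
  of level `|3|` of infinite order (the grid supply's) such that for EVERY non-zero ♯♯-frame with constants `(C, X, Y)`, `X, Y ≠ 0`, there are
  `z ∈ ℤ₃` and an integral `Q ∈ ℂ₃⟦X⟧` with `(1 + X)·Q′ = z·Q`, `Q(0) = 1` and `Q(u − 1) = ((X·κ̂·Y⁻¹)^m)⁻¹`.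
WHAT THIS DOES NOT GIVE (honest): `λ₀ ∈ ℤ₃ˣ` ((N♭)'s `u ∈ ℤ₃ˣ`) — `u = χ(γ₁)` need not lie in `ℚ₃`, and `z/m` need not be `3`-integral; so the
residue between «a non-zero frame exists» and (N♭) is now EXPLICITLY the torsion/rationality index of `u^{z/m}`, no analysis left.

HONEST SCOPE: statements about the interpolation predicate, conditional on `jacquet1972_functionalEquation_rankinSelbergHecke_cone`; nothing here is
evidence that a frame exists at an additive split `3`; BSD is proved for no curve; 24207 / 20395 / 20186 / 32493 OPEN.

References: [cite: Robert2000PadicAnalysis, Ch. V §2.4 Theorem 1; Ch. VI §2.1–2.4] [cite: Gouvea1993PadicNumbers, §5.9 Lemma 5.9.1, Problem 194]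
[cite: HaoLoeffler2025, Thm. 3.5, remark (arXiv:2405.12611)] [cite: Jacquet1972, §19 Cor. 19.15] [cite: deShalit1987, II.4.12 Remarks (iii)–(iv)]
-/

set_option linter.dupNamespace false
set_option autoImplicit false

noncomputable section

open scoped Classical MatrixGroups
open Filter Topology

namespace Summit.BirchSwinnertonDyer.BirchSwinnertonDyer.Theorems.UniversalToricDescentThinComb.WildRigidity

open NumberField IsDedekindDomain Field
open Literature.NumberTheory.EllipticCurves Literature.NumberTheory.GaloisRepresentations Literature.NumberTheory.LocalFields
open Summit.BirchSwinnertonDyer.Rank1Residual.X11b.Halves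
open Summit.BirchSwinnertonDyer.BirchSwinnertonDyer.Theorems.UniversalToricDescentThinComb

variable {K : Type} [Field K] [NumberField K]

/-- The value of a series at `0` is its constant coefficient. [folklore] -/
theorem tsum_coeff_mul_zero_pow {R : Type*} [NormedField R] (Q : PowerSeries R) :
    ∑' n, PowerSeries.coeff n Q * (0 : R) ^ n = PowerSeries.constantCoeff Q := by
  rw [tsum_eq_single 0 (fun n hn ↦ by rw [zero_pow hn, mul_zero])]
  simp

/-- **WILD RIGIDITY OF ♯♯-FRAMES** (`λ₀^{−m} = u^z`, `z ∈ ℤ₃`). `K` imaginary quadratic Heegner for `N`, `3 = 𝔭𝔭′` with `𝔭` of degree one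
induced by `ι′`, `(κ₁, κ₂; γ₁, γ₂)` a generator pair with `κ₁` unramified outside `𝔭`, `f = Dt.f`; Jacquet's cone fact BY NAME. There are an
exponent `m > 0` and a one-unit `u` of level `|3|` of infinite order (those of a grid supply of the pair) such that for EVERY non-zero ♯♯-frame
`L₂` with constants `(C, X, Y)`, `X, Y ≠ 0`: `((X·κ̂·Y⁻¹)^m)⁻¹ = Q(u − 1)` for the binomial series `Q = (1+X)^z` of some `z ∈ ℤ₃`
(`(1 + X)·Q′ = z·Q`, `Q(0) = 1`, `Q` integral), `κ̂ = ι′⁻¹(N·|d_K|/4)`. [cite: Robert2000PadicAnalysis, Ch. V §2.4 Theorem 1; Ch. VI §2.1, §2.4]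
[cite: Gouvea1993PadicNumbers, §5.9 Problem 194] [cite: HaoLoeffler2025, Thm. 3.5, remark (arXiv:2405.12611)] -/
theorem exists_forall_binomialPower_eq_of_isToricTwoVarLFunctionUpTo₂
    (hJ : jacquet1972_functionalEquation_rankinSelbergHecke_cone)
    (hK : IsImaginaryQuadratic K) {N : ℕ} [NeZero N] (W : WeierstrassCurve ℚ)
    (Dt : Literature.NumberTheory.EllipticCurves.ModularForms.ModularParametrizationData W N)
    (hH : SatisfiesHeegnerHypothesis N K)
    {𝔭 : HeightOneSpectrum (𝓞 K)} (h3 : ((3 : ℕ) : 𝓞 K) ∈ 𝔭.asIdeal)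
    {𝔭' : HeightOneSpectrum (𝓞 K)} (h3' : ((3 : ℕ) : 𝓞 K) ∈ 𝔭'.asIdeal) (hne : 𝔭' ≠ 𝔭)
    (ι' : PadicAlgCl 3 ≃+* ℂ) (hι : Summit.BirchSwinnertonDyer.BirchSwinnertonDyer.Theorems.SchneiderFree.BranchInducesPrime 3 ι' 𝔭)
    {κ₁ κ₂ : ZpExtension K 3} {γ₁ γ₂ : absoluteGaloisGroup K} (hpair : ZpExtension.IsTopGeneratorPair κ₁ κ₂ γ₁ γ₂)
    (hur₁ : ∀ v : HeightOneSpectrum (𝓞 K), v ≠ 𝔭 → ∀ 𝔓 ∈ v.primesAbove,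
      𝔓.inertia (absoluteGaloisGroup K) ≤ κ₁.kerSubgroup) :
    ∃ (m : ℕ) (u : ℂ_[3]), 0 < m ∧ ‖u - 1‖ < ‖((3 : ℕ) : ℂ_[3])‖ ∧ (∀ n : ℕ, 0 < n → u ^ n ≠ 1) ∧
      ∀ (ΩK : ℂ) (C X Y : ℂ_[3]) (L₂ : PowerSeries (UnrSeries 3)), X ≠ 0 → Y ≠ 0 →
        IsToricTwoVarLFunctionUpTo₂ C X Y ι' 𝔭 𝔭' κ₁ κ₂ γ₁ γ₂ Dt.f ΩK L₂ → L₂ ≠ 0 →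
        ∃ (z : ℤ_[3]) (Q : PowerSeries ℂ_[3]),
          (1 + PowerSeries.X) * PowerSeries.derivative ℂ_[3] Q = PowerSeries.C (((z : ℚ_[3]) : ℂ_[3])) * Q ∧
          PowerSeries.constantCoeff Q = 1 ∧ (∀ n, ‖PowerSeries.coeff n Q‖ ≤ 1) ∧
          HasSum (fun n ↦ PowerSeries.coeff n Q * (u - 1) ^ n)
            ((X * (((ι'.symm ((N : ℂ) * ((NumberField.discr K).natAbs : ℂ) / 4) : PadicAlgCl 3)) : ℂ_[3]) * Y⁻¹) ^ m)⁻¹ := by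
  letI : Algebra ℤ_[3] (unrIntegers 3) := (toUnr 3).toAlgebra
  -- the frame involution and ONE grid supply of the pair (both independent of the frame)
  obtain ⟨c, hc⟩ := FrameInvolution.exists_not_mem_range_absGaloisRestrict_rat hK
  obtain ⟨τ, hτ⟩ := FrameInvolution.exists_conjInv hK.1 c
  obtain ⟨A, hA, -⟩ := FrameInvolution.exists_GL_eq_frameMatrixOf_of_conjInv hK hpair hτ
  obtain ⟨u, v₁, v₂, m, hm, hu, hv₁, hv₂, hut, hv₂t, grid⟩ :=
    GridSupply.gridSupply hJ (by norm_num) hK W Dt hH h3 h3' hne ι' hι hpair hur₁ hc hτ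
  choose ψ r Lc hinf hunr hr hrκ hLd hLe hx hy using grid
  refine ⟨m, u, hm, hu, hut, fun ΩK C X Y L₂ hX hY hL hL0 ↦ ?_⟩
  -- the reflected frame, the grading ratio (size rigidity: a unit)
  have hG := FrameReflection.isToricTwoVarLFunctionUpTo₂_frameSubst_involution hJ hK Dt.f Dt.isNewformOf.1 hH h3 h3' hne ι'
    hpair hc hτ A hA hL
  set G : PowerSeries (UnrSeries 3) := IwasawaAlgebra₂.frameSubst (unrIntegers 3) A L₂ with hGdef
  have hsize := SizeRigidity.norm_mul_eq_norm_of_isToricTwoVarLFunctionUpTo₂ hJ hK W Dt hH h3 h3' hne ι' hι hpair hur₁ hX hY hL hL0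
  set κh : ℂ_[3] := (((ι'.symm ((N : ℂ) * ((NumberField.discr K).natAbs : ℂ) / 4) : PadicAlgCl 3)) : ℂ_[3]) with hκh
  have hκh0 : κh ≠ 0 := by
    intro h0; rw [h0, mul_zero, norm_zero] at hsize; exact hY (norm_eq_zero.mp hsize.symm)
  set lam : ℂ_[3] := X * κh * Y⁻¹ with hlam
  have hlam1 : ‖lam‖ = 1 := by
    rw [hlam, norm_mul, norm_inv, hsize, mul_inv_cancel₀ (norm_ne_zero_iff.mpr hY)]
  have hμ0 : lam ^ m ≠ 0 := pow_ne_zero _ (norm_pos_iff.mp (by rw [hlam1]; exact one_pos))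
  -- bookkeeping of the grid (as in `…SizeRigidity`, `…TameRigidity`)
  have h31 : ‖((3 : ℕ) : ℂ_[3])‖ < 1 := norm_prime_padicComplex_lt_one
  have h30 : ((3 : ℕ) : ℂ_[3]) ≠ 0 := by exact_mod_cast (show (3 : ℕ) ≠ 0 by norm_num)
  have hc0 : 0 < ‖((3 : ℕ) : ℂ_[3])‖ := norm_pos_iff.mpr h30
  have hu1 : ‖u - 1‖ ≤ 1 := (hu.trans h31).le
  have hv₁1 : ‖v₁ - 1‖ ≤ 1 := (hv₁.trans h31).le
  have hv₂1 : ‖v₂ - 1‖ ≤ 1 := (hv₂.trans h31).le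
  have hu_ne : u ≠ 0 := fun h ↦ by rw [h, zero_sub, norm_neg, norm_one] at hu; exact (lt_irrefl _) (hu.trans h31)
  have hv₁_ne : v₁ ≠ 0 := fun h ↦ by rw [h, zero_sub, norm_neg, norm_one] at hv₁; exact (lt_irrefl _) (hv₁.trans h31)
  have hv₂_ne : v₂ ≠ 0 := fun h ↦ by rw [h, zero_sub, norm_neg, norm_one] at hv₂; exact (lt_irrefl _) (hv₂.trans h31)
  have hv₁n : ‖v₁‖ ≤ 1 := RamifiedSevenEllipticUnits.LemmaXi.norm_le_one_of_norm_sub_one_le_one hv₁1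
  have hv₁pow : ∀ j : ℕ, ‖v₁ ^ (j + 1) - 1‖ < ‖((3 : ℕ) : ℂ_[3])‖ := fun j ↦
    (RamifiedSevenEllipticUnits.LemmaXi.norm_pow_sub_one_le hv₁1 _).trans_lt hv₁
  have hv₂pow : ∀ j : ℕ, ‖v₂ ^ (j + 1) - 1‖ ≤ ‖((3 : ℕ) : ℂ_[3])‖ := fun j ↦
    ((RamifiedSevenEllipticUnits.LemmaXi.norm_pow_sub_one_le hv₂1 _).trans_lt hv₂).le
  have hpt : ∀ i j : ℕ, ‖v₁ ^ (j + 1) * u ^ (i + 1) - 1‖ ≤ ‖((3 : ℕ) : ℂ_[3])‖ := fun i j ↦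
    (FibredSupply.norm_mul_sub_one_lt (by rw [norm_pow]; exact pow_le_one₀ (norm_nonneg _) hv₁n) (hv₁pow j)
      ((RamifiedSevenEllipticUnits.LemmaXi.norm_pow_sub_one_le hu1 _).trans_lt hu)).le
  have hut1 : ∀ t : ℕ, ‖u ^ t - 1‖ ≤ ‖((3 : ℕ) : ℂ_[3])‖ := fun t ↦
    ((RamifiedSevenEllipticUnits.LemmaXi.norm_pow_sub_one_le hu1 t).trans_lt hu).le
  have hinjD : Function.Injective fun j : ℕ ↦ v₂ ^ (j + 1) - 1 := by
    simpa only [one_mul] using FibredSupply.injective_mul_pow_sub_one one_ne_zero hv₂_ne hv₂t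
  have hinjF : ∀ j : ℕ, Function.Injective fun i : ℕ ↦ v₁ ^ (j + 1) * u ^ (i + 1) - 1 := fun j ↦
    FibredSupply.injective_mul_pow_sub_one (pow_ne_zero _ hv₁_ne) hu_ne hut
  -- the two value families on the grid and their relation
  obtain ⟨D, hD⟩ : ∃ D : ℕ → ℕ → ℂ_[3], ∀ i j, D i j =
      (((ι'.symm (toricInterpolationValue 3 Dt.f 𝔭 𝔭' (ψ i j) (m * (i + 1)) (m * (j + 1)) ΩK (Lc i j 1))) : PadicAlgCl 3) :
        ℂ_[3]) := ⟨_, fun _ _ ↦ rfl⟩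
  obtain ⟨VL, hVL⟩ : ∃ VL : ℕ → ℕ → ℂ_[3], ∀ i j, VL i j = C * X ^ (m * (i + 1)) * Y ^ (m * (j + 1)) * D i j :=
    ⟨_, fun _ _ ↦ rfl⟩
  obtain ⟨VG, hVG⟩ : ∃ VG : ℕ → ℕ → ℂ_[3], ∀ i j,
      VG i j = C * (Y * κh⁻¹) ^ (m * (i + 1)) * (X * κh) ^ (m * (j + 1)) * D i j := ⟨_, fun _ _ ↦ rfl⟩
  have ha : ∀ i : ℕ, 1 ≤ m * (i + 1) := fun i ↦ Nat.mul_pos hm (Nat.succ_pos i)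
  have hvalL : ∀ i j, UnrSeries.HasValueAt₂ L₂ (v₁ ^ (j + 1) * u ^ (i + 1) - 1) (v₂ ^ (j + 1) - 1) (VL i j) := by
    intro i j
    have h := hL (ψ i j) _ _ (ha i) (ha j) (hinf i j) (hunr i j) (r i j) (hr i j) (hrκ i j) (Lc i j) (hLd i j) (hLe i j)
    rw [hx i j, hy i j, ← hD] at h
    rwa [hVL]
  have hvalG : ∀ i j, UnrSeries.HasValueAt₂ G (v₁ ^ (j + 1) * u ^ (i + 1) - 1) (v₂ ^ (j + 1) - 1) (VG i j) := by
    intro i j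
    have h := hG (ψ i j) _ _ (ha i) (ha j) (hinf i j) (hunr i j) (r i j) (hr i j) (hrκ i j) (Lc i j) (hLd i j) (hLe i j)
    rw [hx i j, hy i j, ← hD] at h
    rwa [hVG]
  have hrel : ∀ i j, VG i j * (lam ^ m) ^ (i + 1) = (lam ^ m) ^ (j + 1) * VL i j := by
    intro i j
    have e1 : Y * κh⁻¹ * lam = X := by
      rw [hlam]
      calc Y * κh⁻¹ * (X * κh * Y⁻¹) = X * (κh⁻¹ * κh) * (Y * Y⁻¹) := by ring
        _ = X := by rw [inv_mul_cancel₀ hκh0, mul_inv_cancel₀ hY, mul_one, mul_one]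
    have e2 : lam * Y = X * κh := by
      rw [hlam]
      calc X * κh * Y⁻¹ * Y = X * κh * (Y⁻¹ * Y) := by ring
        _ = X * κh := by rw [inv_mul_cancel₀ hY, mul_one]
    rw [← pow_mul, ← pow_mul]
    calc VG i j * lam ^ (m * (i + 1))
        = C * (Y * κh⁻¹ * lam) ^ (m * (i + 1)) * (X * κh) ^ (m * (j + 1)) * D i j := by rw [hVG, mul_pow]; ring
      _ = C * X ^ (m * (i + 1)) * (lam * Y) ^ (m * (j + 1)) * D i j := by rw [e1, e2]
      _ = lam ^ (m * (j + 1)) * VL i j := by rw [hVL, mul_pow]; ring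
  -- a fibre with a non-zero value (else `L₂ = 0`)
  have hex : ∃ j₀ i₀ : ℕ, VL i₀ j₀ ≠ 0 := by
    by_contra hall
    push Not at hall
    apply hL0
    refine ReflectionTransfer.unr_eq_zero_of_infinite_zeros₂_innerFibred h30 h31 (Set.infinite_range_of_injective hinjD) ?_ ?_
    · rintro y ⟨j, rfl⟩; exact hv₂pow j
    · rintro y ⟨j, rfl⟩
      refine Set.infinite_of_injective_forall_mem (hinjF j) fun i ↦ ⟨hpt i j, ?_⟩
      have hv := hvalL i j
      rwa [hall j i] at hv
  obtain ⟨j₀, i₀, hne0⟩ := hex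
  -- the fibre series of `L₂` and `G` at `y₀ = v₂^{j₀+1} − 1`
  have hy0 : ‖v₂ ^ (j₀ + 1) - 1‖ < 1 := (hv₂pow j₀).trans_lt h31
  obtain ⟨F, hFint, hFval⟩ := NodeSeries.exists_fibreSeries L₂ hy0
  obtain ⟨F', hF'int, hF'val⟩ := NodeSeries.exists_fibreSeries G hy0
  have hxlt : ∀ i : ℕ, ‖v₁ ^ (j₀ + 1) * u ^ (i + 1) - 1‖ < 1 := fun i ↦ (hpt i j₀).trans_lt h31
  have hFL : ∀ i : ℕ, ∑' n, PowerSeries.coeff n F * (v₁ ^ (j₀ + 1) * u ^ (i + 1) - 1) ^ n = VL i j₀ := fun i ↦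
    ((hFval _ _ (hxlt i)).mp (hvalL i j₀)).tsum_eq
  have hFG : ∀ i : ℕ, ∑' n, PowerSeries.coeff n F' * (v₁ ^ (j₀ + 1) * u ^ (i + 1) - 1) ^ n = VG i j₀ := fun i ↦
    ((hF'val _ _ (hxlt i)).mp (hvalG i j₀)).tsum_eq
  -- beyond an index `i₁` all node values of `F` are non-zero
  obtain ⟨i₁, hi₁⟩ := NodeSeries.exists_forall_le_ne_zero hFint hc0 h31 (hinjF j₀) (fun i ↦ hpt i j₀) (i₀ := i₀)
    (by simpa only [hFL] using hne0)
  have hVLne : ∀ t : ℕ, VL (i₁ + t) j₀ ≠ 0 := fun t ↦ by rw [← hFL]; exact hi₁ _ (Nat.le_add_right _ _)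
  -- re-centre both fibre series at the node `i₁`
  set a : ℂ_[3] := v₁ ^ (j₀ + 1) * u ^ (i₁ + 1) with ha_def
  have hξ : ‖a - 1‖ ≤ ‖((3 : ℕ) : ℂ_[3])‖ := hpt i₁ j₀
  have ha1 : ‖a‖ ≤ 1 := RamifiedSevenEllipticUnits.LemmaXi.norm_le_one_of_norm_sub_one_le_one (hξ.trans h31.le)
  obtain ⟨H, hHint, hHval⟩ := NodeSeries.exists_recenter_rescale hFint hc0 h31 hξ ha1
  obtain ⟨H', hH'int, hH'val⟩ := NodeSeries.exists_recenter_rescale hF'int hc0 h31 hξ ha1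
  have hnode : ∀ t : ℕ, a * (u ^ t - 1) + (a - 1) = v₁ ^ (j₀ + 1) * u ^ (i₁ + t + 1) - 1 := fun t ↦ by
    rw [ha_def]; ring
  have hHL : ∀ t : ℕ, ∑' n, PowerSeries.coeff n H * (u ^ t - 1) ^ n = VL (i₁ + t) j₀ := fun t ↦ by
    rw [hHval _ (hut1 t), hnode, hFL]
  have hHG : ∀ t : ℕ, ∑' n, PowerSeries.coeff n H' * (u ^ t - 1) ^ n = VG (i₁ + t) j₀ := fun t ↦ by
    rw [hH'val _ (hut1 t), hnode, hFG]
  -- the node relation `H′(uᵗ − 1) = c₀ · dᵗ · H(uᵗ − 1)`, `d = μ⁻¹`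
  set d : ℂ_[3] := (lam ^ m)⁻¹ with hd
  have hd0 : d ≠ 0 := inv_ne_zero hμ0
  set c₀ : ℂ_[3] := (lam ^ m) ^ (j₀ + 1) * d ^ (i₁ + 1) with hc₀
  have hc₀0 : c₀ ≠ 0 := mul_ne_zero (pow_ne_zero _ hμ0) (pow_ne_zero _ hd0)
  have key : ∀ (M vG vL : ℂ_[3]) (t : ℕ), M ≠ 0 → vG * M ^ (i₁ + t + 1) = M ^ (j₀ + 1) * vL →
      vG = M ^ (j₀ + 1) * (M⁻¹) ^ (i₁ + 1) * (M⁻¹) ^ t * vL := by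
    intro M vG vL t hM h
    have hMp : M ^ (i₁ + t + 1) ≠ 0 := pow_ne_zero _ hM
    calc vG = vG * M ^ (i₁ + t + 1) * (M ^ (i₁ + t + 1))⁻¹ := by rw [mul_assoc, mul_inv_cancel₀ hMp, mul_one]
      _ = M ^ (j₀ + 1) * vL * (M ^ (i₁ + t + 1))⁻¹ := by rw [h]
      _ = M ^ (j₀ + 1) * (M⁻¹) ^ (i₁ + 1) * (M⁻¹) ^ t * vL := by
          rw [← inv_pow, show i₁ + t + 1 = (i₁ + 1) + t by ring, pow_add]; ring
  have hrelt : ∀ t : ℕ, ∑' n, PowerSeries.coeff n H' * (u ^ t - 1) ^ n =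
      c₀ * d ^ t * ∑' n, PowerSeries.coeff n H * (u ^ t - 1) ^ n := by
    intro t
    rw [hHL, hHG, hc₀, hd]
    exact key _ _ _ t hμ0 (hrel (i₁ + t) j₀)
  -- the `ℂ_p` node theorem
  have h00 : ∑' n, PowerSeries.coeff n H * (u ^ 0 - 1) ^ n ≠ 0 := by rw [hHL]; exact hVLne 0
  obtain ⟨z, Q, hHQ, hODE, hQbd⟩ :=
    PadicComplex.exists_padicInt_binomial_twist_of_node_values hHint hH'int (hu.trans h31) hut hc₀0 hd0 hrelt h00
  -- evaluate `H′ = Q·H` at the nodes: `Q(uᵗ − 1) = c₀·dᵗ`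
  have hQres : PowerSeries.IsRestricted ‖((3 : ℕ) : ℂ_[3])‖ Q := isRestricted_of_norm_coeff_le hQbd hc0.le h31
  have hHres : PowerSeries.IsRestricted ‖((3 : ℕ) : ℂ_[3])‖ H := isRestricted_of_norm_coeff_le hHint hc0.le h31
  have hQt : ∀ t : ℕ, ∑' n, PowerSeries.coeff n Q * (u ^ t - 1) ^ n = c₀ * d ^ t := by
    intro t
    have h1 : (∑' n, PowerSeries.coeff n Q * (u ^ t - 1) ^ n) * VL (i₁ + t) j₀ = c₀ * d ^ t * VL (i₁ + t) j₀ := by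
      rw [← hHL t, ← tsum_coeff_mul hQres hHres (hut1 t), ← hHQ, hrelt t]
    exact mul_right_cancel₀ (hVLne t) h1
  have hQ0 : PowerSeries.constantCoeff Q = c₀ := by
    have h := hQt 0
    rwa [pow_zero, sub_self, pow_zero, mul_one, tsum_coeff_mul_zero_pow] at h
  have hQ1 : ∑' n, PowerSeries.coeff n Q * (u - 1) ^ n = c₀ * d := by simpa using hQt 1
  -- normalise `Q` by its constant term
  refine ⟨z, PowerSeries.C c₀⁻¹ * Q, ?_, ?_, ?_, ?_⟩
  · rw [Derivation.leibniz, PowerSeries.derivative_C, smul_zero, add_zero, smul_eq_mul, ← mul_assoc, mul_comm (1 + PowerSeries.X),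
      mul_assoc, hODE]
    ring
  · rw [map_mul, PowerSeries.constantCoeff_C, hQ0, inv_mul_cancel₀ hc₀0]
  · intro n
    rw [PowerSeries.coeff_C_mul, norm_mul, norm_inv]
    calc ‖c₀‖⁻¹ * ‖PowerSeries.coeff n Q‖ ≤ ‖c₀‖⁻¹ * ‖c₀‖ := by
          gcongr; rw [← hQ0]; exact hQbd n
      _ = 1 := inv_mul_cancel₀ (norm_ne_zero_iff.mpr hc₀0)
  · have hsum := (Literature.NumberTheory.LocalFields.summable_coeff_mul_pow hQres (x := u - 1) hu.le).hasSum
    rw [hQ1] at hsum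
    have h2 := hsum.mul_left c₀⁻¹
    rw [inv_mul_cancel_left₀ hc₀0] at h2
    refine h2.congr_fun fun n ↦ ?_
    rw [PowerSeries.coeff_C_mul, mul_assoc]

end Summit.BirchSwinnertonDyer.BirchSwinnertonDyer.Theorems.UniversalToricDescentThinComb.WildRigidity

end
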